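import Summits.QuantumFields.BalabanUV.Beta.EriceRemainderEnclosureHistoryAutonomyComparisonAgeCompositionStaticChainFluidDomination

/-!
# EriceRemainderEnclosureHistoryAutonomyComparisonAgeCompositionStaticChainRatioDomination — (E73b) RATIO DOMINATION (the fluid dominates the spike's
# compounding over EVERY window of consumed load) and the (S1)-FREE ABEL MAJORANT of the load a young age sees from «spike + comb»

Cell `pub-balaban`, β-function sub-cell, BINDER row D4 «RemainderConst leaves for Bałaban's split» (`HOME/BINDER-OWNERS.md`; owner lineage `b2b-balaban-beta-an4`;
this file by co-owner #2 lineage `b2b-balaban-beta-d4-p2`, generation 64), β-FLOW TEAM duty (1), FREEZE (0) honoured (def-free; imports (E73a)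
`…StaticChainFluidDomination` for `spike_le_fluid`, `consumed_mono`, `compounding_succ` and, through it, (E72a) `…StaticChain` for `load_abel` — used BY NAME;
nothing restated).

HONEST FRAMING (page 1, verbatim and binding).  *"Discharging BetaPertH makes Bałaban's UV stability UNCONDITIONAL — a real constructive-QFT result; it is
NOT the continuum limit and NOT the Clay problem."*  THIS FILE DISCHARGES NOTHING OF THE KIND.  Elementary real analysis and finite-sum algebra about the
census's own FIRST-ORDER static chain over NOT-IN-PRINT binders; the form, signs, ages and moments of Bałaban's (1.22) limit functional are NOT PRINTED ([I]
p. 298; GAPS G-t4-U2-1∕-2) and NOT asserted.  Row D4 class UNCHANGED (critical-path width 0; instance 0∕1; D4 DISCHARGE NO DATE).  HONEST DEPENDENCY: continuum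
YM on T⁴ ⇐ BetaPertH ∧ nine spine estimates (0/9 proved); BetaPertH ⇐ (D1) ∧ (D4) ∧ CAP+tail; G-an2-4 gates asym, D1 and NE2/3/4.

THE POINT (census sense (α); route (N); README `g63/e72` §7: the near-window lemmas (NW-T)∕(NW-ρ) were reduced there to a low-dimensional computation MODULO
(S1) «spike reduction» (the supremum is attained on «uniform spike + comb») and (S2) «fluid domination»; (E73a) proved (S2); THIS FILE REMOVES (S1) FROM THE
LOGICAL PATH for the compounding and for the young age's load).  §1 **`spike_ratio_le_fluid`**: in the setting of (E73a) `spike_le_fluid`, for ALL `i ≤ m ≤ M`,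
`E_m·F(t_i) ≤ E_i·F(t_m)` — the spike's compounding over ANY window of consumed load is dominated by the fluid's growth over the same window.  (The sub-chain
from member `i` obeys the step inequality with `θ ← θ·F(t_i)` because `E_i ≤ F(t_i)`, and `s ↦ F(s)∕F(t_i)` is a Riccati fluid of exactly that kind — the flow
property; apply `spike_le_fluid` to it.)  §2 **`near_load_le_abel_fluid`**: by (E72a) `load_abel` the load a YOUNGER age sees from the spike is
`Σ_i (θ^y_i − θ^y_{i−1})·(E_M∕E_i − 1)` with its own defects `θ^y_i` (non-decreasing towards it) and the SUFFIX compoundings `E_M∕E_i`; by §1 each is `≤ F(t_M)∕F(t_i)`,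
so **`Σ_i θ^y_i·ρ_i·Π_{i≤j<M}(1−ρ_j)⁻¹ ≤ Σ_i (θ^y_i − θ^y_{i−1})·(F(t_M)∕F(t_i) − 1)`** — an EXPLICIT functional of the near profile (positions through `θ^y_i`,
loads through `t_i`) and of the far parameters inside `F`, valid for EVERY discrete configuration: no rearrangement∕argmax statement is needed.  §3
**`young_load_le_abel_fluid`**: adding the far load compounded through the spike (`V^far ≤ Λ_z·E_M ≤ Λ_z·F(t_M)`), the young age's whole chain load, hence
`T = x_z·V` and `ρ_z = x_z(1+V)∕(1−Ω_z)`, are majorised by explicit functions of the profile.  WHAT THIS BUYS AND WHAT IT COSTS (numerics `g64/numerics/t40–t42`,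
z = 24–40): the worst-constant fluid (`θ̄(1) = 0.786`, `c = 2(√2−1)`) is position-blind in the MUTUAL compounding — exact for a dense cluster, lossy for spread
load: with the spike alone as «near» and an octave comb as «far» (its true ratios), `T_maj∕T = 1.05–1.25` for spike loads `X ≤ 0.4` (sup `T_maj ≈ 0.21–0.24`
against the true `0.17–0.18`); with ONE fluid over the whole five-octave window `(z, 32z]`, an octave-spread load of `0.1` per octave is over-counted `3×` in `ν`
(`0.69` vs `0.23`; `T_maj = 0.30` vs `0.10`) and the fluid dies (`θq ≥ 1`) for window loads `≥ 0.65` — so this file's majorant is the tool for ONE DENSE BIN,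
and a near window is to be cut into ratio bins, each with its own fluid (incoming load `Λ_b` = the older bins' carried masses with worst bin-pair defects,
which keeps the form `(1−θ̄(1)) + (θ̄(1)+Λ_b)E`), the young age's Abel sum collapsing to one increment per bin (README `g64/e73` §3–§4).  NOT CLAIMED: (NW-T),
(NW-ρ), (S1), MONO, anything nonlinear, anything printed.
-/
noncomputable section

open Set Finset

namespace Summit.QuantumFields.BalabanUV.Beta.EriceRemainderEnclosureHistoryAutonomyComparisonAgeCompositionStaticChainRatioDomination

open Summit.QuantumFields.BalabanUV.Beta.EriceRemainderEnclosureHistoryAutonomyComparisonAgeCompositionStaticChain (load_abel)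
open Summit.QuantumFields.BalabanUV.Beta.EriceRemainderEnclosureHistoryAutonomyComparisonAgeCompositionStaticChainFluidDomination
  (spike_le_fluid consumed_mono compounding_succ)

/-! ## §1 Ratio domination: the fluid dominates the spike's compounding over every window of consumed load -/

/-- **RATIO DOMINATION.**  In the setting of (E73a) `spike_le_fluid` (fluid `F > 0` on `[0, X]`, `F' = F(a + θF)∕(D₀ − κ's)`, positive rate, `κ' ≥ max(κ, a)`,
`θ ≥ 0`; discrete spike `t_{m+1} = t_m + h_m`, `E_{m+1} = E_m∕(1−ρ_m)`, `0 < E_0 ≤ F(t_0)`, step inequality `ρ_m ≤ h_m(a + θE_m)∕(D₀ − κt_m)` with the FULL prefix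
compounding `E_m`): for all `i ≤ m ≤ M`, **`E_m·F(t_i) ≤ E_i·F(t_m)`**, i.e. `E_m∕E_i ≤ F(t_m)∕F(t_i)` — the compounding of the members in ANY window of consumed
load is dominated by the fluid's growth over the same window (not only from the start).  Proof: the sub-chain from member `i` satisfies the step inequality with
`θ ← θ·F(t_i)` (since `E_i ≤ F(t_i)`), and `s ↦ F(s)∕F(t_i)` is a fluid of exactly that kind (the flow property of the Riccati fluid); apply `spike_le_fluid` to it.
USE: the suffix compoundings `Π_{i≤j<m}(1−ρ_j)⁻¹` in (E72a)'s ABEL FORM of the load seen by the young age (§2). [folklore] -/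
theorem spike_ratio_le_fluid {F : ℝ → ℝ} {a θ κ κ' D0 X : ℝ} {h t E ρ : ℕ → ℝ} {M : ℕ}
    (hθ : 0 ≤ θ) (hκκ' : κ ≤ κ') (haκ : a ≤ κ')
    (hpos : ∀ s ∈ Icc (0:ℝ) X, 0 < a + θ * F s) (hD : ∀ s ∈ Icc (0:ℝ) X, 0 < D0 - κ' * s)
    (hF : ∀ s ∈ Icc (0:ℝ) X, HasDerivAt F (F s * (a + θ * F s) / (D0 - κ' * s)) s)
    (hFpos : ∀ s ∈ Icc (0:ℝ) X, 0 < F s)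
    (hh : ∀ m, 0 ≤ h m) (ht0 : 0 ≤ t 0) (ht : ∀ m, t (m + 1) = t m + h m) (htM : t M ≤ X)
    (hE0 : 0 < E 0) (hEF : E 0 ≤ F (t 0)) (hE : ∀ m, E (m + 1) = E m / (1 - ρ m))
    (hρ : ∀ m, m < M → ρ m ≤ h m * ((a + θ * E m) / (D0 - κ * t m))) :
    ∀ i m, i ≤ m → m ≤ M → E m * F (t i) ≤ E i * F (t m) := by
  intro i m him hmM
  have hbase := spike_le_fluid hθ hκκ' haκ hpos hD hF hFpos hh ht0 ht htM hE0 hEF hE hρ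
  have hiM : i ≤ M := him.trans hmM
  have hEi : 0 < E i := (hbase i hiM).1.1
  have hEiF : E i ≤ F (t i) := (hbase i hiM).1.2
  have htI : ∀ n, n ≤ M → t n ∈ Icc (0:ℝ) X := fun n hn =>
    ⟨ht0.trans (consumed_mono hh ht (Nat.zero_le n)), (consumed_mono hh ht hn).trans htM⟩
  have hFi : 0 < F (t i) := hFpos (t i) (htI i hiM)
  have e1 : ∀ s, θ * F (t i) * (F s / F (t i)) = θ * F s := fun s => by field_simp
  -- the shifted chain from member `i`, against the fluid `F∕F(t_i)` with `θ ← θ·F(t_i)`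
  have key := spike_le_fluid (F := fun s => F s / F (t i)) (θ := θ * F (t i)) (κ := κ) (κ' := κ') (a := a) (D0 := D0) (X := X)
      (h := fun n => h (i + n)) (t := fun n => t (i + n)) (E := fun n => E (i + n) / E i) (ρ := fun n => ρ (i + n))
      (M := m - i) (mul_nonneg hθ hFi.le) hκκ' haκ
      (fun s hs => by rw [e1]; exact hpos s hs) hD
      (fun s hs => by
        have h1 := (hF s hs).div_const (F (t i))
        refine h1.congr_deriv ?_
        rw [e1]
        ring)
      (fun s hs => div_pos (hFpos s hs) hFi)
      (fun n => hh (i + n)) (htI i hiM).1 (fun n => ht (i + n))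
      (by rw [Nat.add_sub_cancel' him]; exact (consumed_mono hh ht hmM).trans htM)
      (by simp only [Nat.add_zero, div_self hEi.ne']; exact one_pos)
      (by simp only [Nat.add_zero, div_self hEi.ne', div_self hFi.ne']; exact le_rfl)
      (fun n => by show E (i + n + 1) / E i = _; rw [hE (i + n), div_right_comm])
      (fun n hn => by
        have hn' : i + n < M := by omega
        have hEn : 0 < E (i + n) := (hbase (i + n) hn'.le).1.1
        have htn := htI (i + n) hn'.le
        have hQ : 0 < D0 - κ * t (i + n) := by nlinarith [hD _ htn, htn.1]
        have h2 : a + θ * E (i + n) ≤ a + θ * F (t i) * (E (i + n) / E i) := by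
          have h3 : θ * E (i + n) = θ * E i * (E (i + n) / E i) := by field_simp
          rw [h3]
          have h4 : 0 ≤ θ * (E (i + n) / E i) := mul_nonneg hθ (div_pos hEn hEi).le
          nlinarith [mul_le_mul_of_nonneg_left hEiF h4]
        exact (hρ (i + n) hn').trans
          (mul_le_mul_of_nonneg_left (div_le_div_of_nonneg_right h2 hQ.le) (hh (i + n))))
  have hle := (key (m - i) le_rfl).1.2
  rw [Nat.add_sub_cancel' him, div_le_div_iff₀ hEi hFi] at hle
  linarith

/-! ## §2 The Abel majorant of the load a young age sees from the spike -/

/-- **THE ABEL MAJORANT OF THE NEAR LOAD ((S1)-free).**  A discrete spike as in `spike_ratio_le_fluid` with `E_m = Π_{j<m}(1−ρ_j)⁻¹` (so `E_0 = 1 ≤ F(t_0)`), seen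
from a YOUNGER age with defects `θ^y_i` non-decreasing in the processing order (oldest first: persistence defects `θ̄(k_i∕z)` grow as the members approach the young
age; predecessor sequence `θp`, `θp_0 = 0`, `θp_{i+1} = θ^y_i`).  Then the load the young age sees from the spike obeys
**`Σ_{i<M} θ^y_i·ρ_i·Π_{i≤j<M}(1−ρ_j)⁻¹ ≤ Σ_{i<M} (θ^y_i − θ^y_{i−1})·(F(t_M)∕F(t_i) − 1)`** — (E72a) `load_abel` with every suffix compounding `E_M∕E_i` replaced by the
fluid's growth `F(t_M)∕F(t_i)` (§1).  The right side is an EXPLICIT functional of the profile (positions enter through `θ^y_i`, loads through `t_i`) and of the far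
parameters inside `F`; no rearrangement statement (README `g63/e72` §7 (S1)) is used. [folklore] -/
theorem near_load_le_abel_fluid {F : ℝ → ℝ} {a θ κ κ' D0 X : ℝ} {h t ρ : ℕ → ℝ} {M : ℕ}
    (hθ : 0 ≤ θ) (hκκ' : κ ≤ κ') (haκ : a ≤ κ')
    (hpos : ∀ s ∈ Icc (0:ℝ) X, 0 < a + θ * F s) (hD : ∀ s ∈ Icc (0:ℝ) X, 0 < D0 - κ' * s)
    (hF : ∀ s ∈ Icc (0:ℝ) X, HasDerivAt F (F s * (a + θ * F s) / (D0 - κ' * s)) s)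
    (hFpos : ∀ s ∈ Icc (0:ℝ) X, 0 < F s)
    (hh : ∀ m, 0 ≤ h m) (ht0 : 0 ≤ t 0) (ht : ∀ m, t (m + 1) = t m + h m) (htM : t M ≤ X)
    (hF0 : 1 ≤ F (t 0))
    (hρ : ∀ m, m < M → ρ m ≤ h m * ((a + θ * ∏ j ∈ range m, (1 - ρ j)⁻¹) / (D0 - κ * t m)))
    (θy θp : ℕ → ℝ) (h0 : θp 0 = 0) (hp : ∀ i, θp (i + 1) = θy i) (hmono : ∀ i, i < M → θp i ≤ θy i) :
    ∑ i ∈ range M, θy i * (ρ i * ∏ j ∈ Ico i M, (1 - ρ j)⁻¹) ≤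
      ∑ i ∈ range M, (θy i - θp i) * (F (t M) / F (t i) - 1) := by
  have hE : ∀ m, (∏ j ∈ range (m + 1), (1 - ρ j)⁻¹) = (∏ j ∈ range m, (1 - ρ j)⁻¹) / (1 - ρ m) := compounding_succ ρ
  have hE0 : 0 < ∏ j ∈ range 0, (1 - ρ j)⁻¹ := by simp
  have hEF : (∏ j ∈ range 0, (1 - ρ j)⁻¹) ≤ F (t 0) := by simpa using hF0
  have hbase := spike_le_fluid (E := fun m => ∏ j ∈ range m, (1 - ρ j)⁻¹) hθ hκκ' haκ hpos hD hF hFpos hh ht0 ht htM hE0 hEF hE hρ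
  have hratio := spike_ratio_le_fluid (E := fun m => ∏ j ∈ range m, (1 - ρ j)⁻¹) hθ hκκ' haκ hpos hD hF hFpos hh ht0 ht htM hE0 hEF hE hρ
  have hρ1 : ∀ j, j < M → ρ j ≠ 1 := fun j hj => ((hbase j hj.le).2 hj).ne
  have htI : ∀ n, n ≤ M → t n ∈ Icc (0:ℝ) X := fun n hn =>
    ⟨ht0.trans (consumed_mono hh ht (Nat.zero_le n)), (consumed_mono hh ht hn).trans htM⟩
  rw [load_abel hρ1 θy θp h0 hp]
  refine sum_le_sum fun i hi => ?_
  have hiM : i < M := mem_range.mp hi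
  refine mul_le_mul_of_nonneg_left (sub_le_sub_right ?_ 1) (sub_nonneg.mpr (hmono i hiM))
  -- suffix compounding = ratio of prefix compoundings ≤ ratio of the fluid
  have hEi : 0 < ∏ j ∈ range i, (1 - ρ j)⁻¹ := (hbase i hiM.le).1.1
  have hFi : 0 < F (t i) := hFpos _ (htI i hiM.le)
  have hsplit : (∏ j ∈ range i, (1 - ρ j)⁻¹) * ∏ j ∈ Ico i M, (1 - ρ j)⁻¹ = ∏ j ∈ range M, (1 - ρ j)⁻¹ :=
    prod_range_mul_prod_Ico _ hiM.le
  have h1 := hratio i M hiM.le le_rfl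
  rw [le_div_iff₀ hFi]
  calc (∏ j ∈ Ico i M, (1 - ρ j)⁻¹) * F (t i)
      = ((∏ j ∈ range M, (1 - ρ j)⁻¹) * F (t i)) / ∏ j ∈ range i, (1 - ρ j)⁻¹ := by
        rw [← hsplit, mul_assoc, mul_div_cancel_left₀ _ hEi.ne']
    _ ≤ ((∏ j ∈ range i, (1 - ρ j)⁻¹) * F (t M)) / ∏ j ∈ range i, (1 - ρ j)⁻¹ := div_le_div_of_nonneg_right h1 hEi.le
    _ = F (t M) := mul_div_cancel_left₀ _ hEi.ne'

/-! ## §3 The young age's view of «spike + comb» -/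

/-- **THE YOUNG AGE'S CHAIN LOAD, MAJORISED WITHOUT (S1).**  If the load a young age sees splits as `V = V^far + V^near` with the FAR part compounded through the
spike, `V^far ≤ Λ_z·E_M` (`Λ_z ≥ 0` the far load it sees at the split; (E72b) `load_split`'s factorisation), and the near part the Abel sum of
`near_load_le_abel_fluid`, then **`V ≤ Λ_z·F(t_M) + Σ_{i<M} (θ^y_i − θ^y_{i−1})(F(t_M)∕F(t_i) − 1)`** — an explicit function of the near profile and the far
parameters; hence `T = x_z·V` and `ρ_z = x_z(1+V)∕(1−Ω_z)` are majorised by explicit functions for every configuration (the certified-computation form of the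
near-window lemmas (NW-T)∕(NW-ρ) of README `g63/e72` §7, with the worst-constant fluid in place of the spike reduction). [folklore] -/
theorem young_load_le_abel_fluid {F : ℝ → ℝ} {a θ κ κ' D0 X : ℝ} {h t ρ : ℕ → ℝ} {M : ℕ}
    (hθ : 0 ≤ θ) (hκκ' : κ ≤ κ') (haκ : a ≤ κ')
    (hpos : ∀ s ∈ Icc (0:ℝ) X, 0 < a + θ * F s) (hD : ∀ s ∈ Icc (0:ℝ) X, 0 < D0 - κ' * s)
    (hF : ∀ s ∈ Icc (0:ℝ) X, HasDerivAt F (F s * (a + θ * F s) / (D0 - κ' * s)) s)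
    (hFpos : ∀ s ∈ Icc (0:ℝ) X, 0 < F s)
    (hh : ∀ m, 0 ≤ h m) (ht0 : 0 ≤ t 0) (ht : ∀ m, t (m + 1) = t m + h m) (htM : t M ≤ X)
    (hF0 : 1 ≤ F (t 0))
    (hρ : ∀ m, m < M → ρ m ≤ h m * ((a + θ * ∏ j ∈ range m, (1 - ρ j)⁻¹) / (D0 - κ * t m)))
    (θy θp : ℕ → ℝ) (h0 : θp 0 = 0) (hp : ∀ i, θp (i + 1) = θy i) (hmono : ∀ i, i < M → θp i ≤ θy i)
    {V Vfar Λz : ℝ} (hΛ : 0 ≤ Λz) (hfar : Vfar ≤ Λz * ∏ j ∈ range M, (1 - ρ j)⁻¹)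
    (hV : V = Vfar + ∑ i ∈ range M, θy i * (ρ i * ∏ j ∈ Ico i M, (1 - ρ j)⁻¹)) :
    V ≤ Λz * F (t M) + ∑ i ∈ range M, (θy i - θp i) * (F (t M) / F (t i) - 1) := by
  have hE : ∀ m, (∏ j ∈ range (m + 1), (1 - ρ j)⁻¹) = (∏ j ∈ range m, (1 - ρ j)⁻¹) / (1 - ρ m) := compounding_succ ρ
  have hE0 : 0 < ∏ j ∈ range 0, (1 - ρ j)⁻¹ := by simp
  have hEF : (∏ j ∈ range 0, (1 - ρ j)⁻¹) ≤ F (t 0) := by simpa using hF0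
  have hEM := (spike_le_fluid (E := fun m => ∏ j ∈ range m, (1 - ρ j)⁻¹) hθ hκκ' haκ hpos hD hF hFpos hh ht0 ht htM hE0 hEF hE hρ
    M le_rfl).1.2
  have hnear := near_load_le_abel_fluid hθ hκκ' haκ hpos hD hF hFpos hh ht0 ht htM hF0 hρ θy θp h0 hp hmono
  rw [hV]
  nlinarith [mul_le_mul_of_nonneg_left hEM hΛ]

end Summit.QuantumFields.BalabanUV.Beta.EriceRemainderEnclosureHistoryAutonomyComparisonAgeCompositionStaticChainRatioDomination

end
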